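import Mathlib
import HarnessLib
import HarnessLib.Audit
import Summits.RiemannHypothesis.Statement
import Literature.NumberTheory.LFunctions.ZetaScrew
import Literature.NumberTheory.LFunctions.GeneralizedRH
import HarnessLib.Audit.Status.Attr

/-!
Route: ScrewExcursionDoor

# Route ScrewExcursionDoor — Measure-graded Landau door — finite Laplace mass of Ψ's deep negative
excursions detects RH

D-0145 LINE (seat rh-idea-9, technique ASSUME-THE-OPPOSITE; screw column S/X, bears_on R0 splitting
search and the robust-Landau door of
IntegerScrew.DiscreteLandau = stmt-RiemannHypothesis-15758). It suffices to show X = ExcursionDoor ∧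
ExcursionResidual. ExcursionDoor
(RH-FREE, graded, the attacked conjunct): for η > 0, if for some θ, σ₀ < η the θ-DEFICIT (−Ψ(t) −
e^{θt})⁺ of Suzuki's screw function
Ψ = zetaScrew has finite Laplace mass ∫_0^∞ (−Ψ−e^{θt})⁺ e^{−σ₀t} dt < ∞, then ζ has no zero with
1/2+η < Re s < 1 (QuasiRH(1/2+η)).
Contrapositive = the minimal-counterexample portrait the seat was asked for: ONE off-line zero at
1/2+η₁ forces, for every θ, σ₀ < η₁,
the excursion set E⁻_θ = {t : Ψ(t) < −e^{θt}} to carry INFINITE e^{−σ₀t}-weighted deficit — deep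
negative excursions are not Laplace-rare.
ExcursionResidual (for every η > 0 some such θ, σ₀ exist) is the DECLARED RESIDUAL
(RH-EQUIVALENT·DERIVED: ⟸ RH since Ψ ≥ 0 makes the
deficit vanish, Suzuki Thm 1.7; ⟹ RH by the door), refutation budget only. No summit is proved by a
line. Nothing here bears on the truth
of RH.
Lean: `ExcursionDoor ∧ ExcursionResidual`

## Assembly
Pure logic (sorry-free in Sketch.lean and glue.lean): `closes (hD : ExcursionDoor) (hR :
ExcursionResidual) : Summit.RiemannHypothesis` —
for a zero s with 1/2 < Re s < 1 take η = (Re s − 1/2)/2, get θ, σ₀ from hR, contradict hD;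
QuasiRH(1/2) ⇒ RH by the tree's
quasiRiemannHypothesis_one_half_iff_holds. Both binders consumed; ExcursionDoor attacked,
ExcursionResidual the named residual.

Rationale: WHY THIS LINE. The tree's one-sided doors for Ψ are POINTWISE: Ψ ≥ 0 (Suzuki2023 Thm 1.7,
riemannHypothesis_of_zetaScrew_nonneg), Ψ ≥ −K
(IntegerScrewDiscreteLandau.robustLandau), and for ψ(x)−x the graded eventual bound
(PfPersistenceDilatingLandau, MontgomeryVaughan2007
Thm 15.3). This line replaces "everywhere / eventually" by "off an exceptional set of finite Laplace
mass": split g = (Ψ+e^{θt})⁺ ≥ 0,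
whose transform is L_Ψ(s) + 1/(s−θ) + L_D(s) with L_D holomorphic on Re s > σ₀
(MontgomeryVaughan2007 Lemma 15.1 applied to g; L_Ψ =
−Σ m_ρ/(s(s²−κ_ρ²)) from Suzuki2023 Thm 1.1), so the abscissa is a real singularity ≤ max(θ,σ₀,0)
and every pole κ_ρ has Re ≤ that.
Imported: Tauberian one-sided theory with an exceptional set (the Kaczorowski–Pintz
measure-of-oscillation viewpoint, doi:10.1007/bf01949062,
transplanted from sign-change counting to Laplace mass). No listed route grades a door by the SIZE
OF THE EXCEPTIONAL SET; the negatives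
index (4 entries) is untouched.

RANKED CRUXES. #2 ExcursionDoor (crux) — RH-FREE MEASURE-GRADED LANDAU DOOR: for every η > 0 and θ,
σ₀ < η, integrability on [0,∞) of t ↦ (−Ψ(t) − e^{θt})⁺·e^{−σ₀t} implies
QuasiRiemannHypothesis(1/2+η) (no zero of ζ with 1/2+η < Re s < 1). [difficulty: L] (why it might
fail: Landau's lemma needs the continued transform −Σ m_ρ/(s(s²−κ_ρ²)) + 1/(s−θ) + L_D pole-free on
the real ray (max(θ,σ₀,0),∞): a real zero of ζ in (1/2,1) would break it (none: (1−2^{1−σ})ζ(σ) >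
0); remaining risk is size (L: Laplace bookkeeping).) [Suzuki2023, MontgomeryVaughan2007,
doi:10.1007/bf01949062, doi:10.1007/bf01951008]
#7 ExcursionResidual (crux) — DECLARED RESIDUAL (RH-EQUIVALENT·DERIVED; refutation budget only): for
every η > 0 there are θ, σ₀ < η with the θ-deficit of Ψ of finite e^{−σ₀t}-Laplace mass on [0,∞). ⟸
RH (deficit ≡ 0 with θ = σ₀ = −1, tree zetaScrew_nonneg_of_RH); ⟹ RH by ExcursionDoor. Instrument:
any certified Ψ(t) < 0 (IntegerScrew node certificates Ψ(log M), screwPivot ladder) refutes RH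
outright; the excursion budget ∫_{E⁻_θ} is the object handed to the search. [deps: ExcursionDoor]
[difficulty: open-problem] (why it might fail: Equivalent to RH given the door: fails iff ζ has an
off-line zero at 1/2+η₁, which forces infinite e^{−σ₀t}-deficit mass on E⁻_θ for all θ, σ₀ < η₁;
nobody is asked to prove it.) [Suzuki2023, arXiv:2209.12349]

TWO-LAYER PLAN. ExcursionDoor ⇐ stub_perturbedLandau (robust Landau with a SLACK FUNCTION D ≥ 0 of
Laplace class β: Ψ ≥ −D on [0,∞), D·e^{−βt}
integrable ⇒ QuasiRH(1/2+β)) → stub_deficitSlack (the θ-deficit + e^{θt} is such a slack for every β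
∈ (max(θ,σ₀,0), η)) → ExcursionDoor —
registered BC3 skeleton bc/ExcursionDoor_birth.lean (ExcursionDoor_of kernel-checked; 2 sorries = 2
stubs).

KILL CRITERIA. Any certified Ψ(t₀) < 0 refutes ExcursionResidual and RH (close
refuted:ExcursionResidual). A real singularity of the continued
transform on (max(θ,σ₀,0), ∞) other than listed would kill ExcursionDoor as typed (pivot: add the
offending abscissa to the max). If
stub_perturbedLandau is refuted for some admissible D the line is dead; if it lands, the door
follows in one step.

NOT DECOMPOSED YET. Effective constants (Knapowski–Turán power sums / Kaczorowski–Pintz: deficit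
mass ≥ explicit in every [T,(1+ε)T]) are layer-2 children;
the width law of excursions (prime-side semiconcavity) lives on the sibling line ScrewQuarticNodes;
measurability side conditions are
inside stub_deficitSlack.

CHEAPEST FALSIFIER. Lookup: does L_Ψ(s) = ∫_0^∞ Ψ e^{−st} dt have a REAL pole in (0, 1/2)? By
Suzuki2023 Thm 1.1 (tree Suzuki2023_thm11_series_holds) L_Ψ =
−Σ_ρ m_ρ/(s(s²−(ρ−1/2)²)): real poles ⇔ real zeros ρ ∈ (0,1) of ζ — none ((1−2^{1−σ})ζ(σ) = η(σ) >
0). Checked by hand; a refuter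
confirms from Mathlib's riemannZeta facts in minutes. Under RH the residual holds with θ = σ₀ = −1
(proved `example` in Sketch.lean).

NUMBERS. Deficit depth scale e^{θt}, Laplace weight e^{−σ₀t}, conclusion QuasiRH(1/2+η) for any η >
max(θ,σ₀); robustLandau = the case D ≡ K
(class β for every β > 0); trivial RH-free envelope |Ψ(t)| ≤ 2(Σ_ρ m_ρ/|ρ−1/2|²)·cosh(t/2), Σ_ρ
1/|ρ−1/2|² ≈ 0.046.

DEFINITION REQUESTS. None.

Novelty: Searches (2026-08-27): lean search
'robustLandau|riemannXi_ne_zero_of_zetaScrew_nonneg|QuasiRiemannHypothesis' (tree doors: pointwise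
only); ledger negatives (4, unrelated); lit search --hybrid "one-sided oscillation theorem
exceptional set Landau lemma Laplace transform"
(10 docs, none relevant); lit search "Kaczorowski Pintz oscillatory properties arithmetical
functions" ([corpus:paper:doi-10-1007-bf01951008
p.2]: sign changes with oscillation x^{θ−ε} in every [Y^{1−ε},Y] — localisation, not Laplace mass);
lit galaxy search "screw
function|Kreĭn–Langer|negative definite kernel zeta" --star all (21 rows, no mathematical hit); lit
galaxy search "comparative prime-number
theory|Knapowski and Tur|one-sided theorem of Landau" --star panama ([galaxy:panama:297143017406558]
Ellison, Prime Numbers: Landau's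
theorem; [galaxy:panama:491361438531689] Journées Arithmétiques 1983).
Nearest prior art found: tree IntegerScrewDiscreteLandau.robustLandau (constant slack) and
PfPersistenceDilatingLandau (eventual one-sided
bounds, MontgomeryVaughan2007 Thm 15.3); doi:10.1007/bf01949062 (Kaczorowski–Pintz I: oscillations
localised in [Y^{1−ε},Y]); Suzuki2023
Thm 1.7.
Delta: the door is graded by the LAPLACE MASS OF THE EXCEPTIONAL SET (slack function of class β
instead of a constant), giving the typed
portrait "one off-line zero ⇒ infinite weighted deficit on E⁻_θ for all θ, σ₀ below its abscissa"
for Suzuki's Ψ — a quantification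
neither the tree's doors nor Kaczorowski–Pintz's interval loca  [refs: 10.1007/bf01949062, paper:doi-10-1007-bf01951008, doi:10.1007/bf01949062, MontgomeryVaughan2007, Suzuki2023]

Barriers (technique_class: one-sided-landau, exceptional-set, laplace-transform): - technique_class: one-sided-landau, exceptional-set, laplace-transform
- Literature.Barriers.RiemannHypothesis.LittlewoodOscillation: outside — the reader is Suzuki's Ψ
(positivity RH-equivalent, tree Suzuki2023_thm17_holds) at depth e^{θt} in t = log x, i.e.
x^{1/2+θ}-scale oscillations of ψ, beyond Littlewood's √x·logloglog x; the hypothesis is RH-implied,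
so Ω± under RH never refutes it.
- Literature.Barriers.RiemannHypothesis.DiamondMontgomeryVorhauer2006_thm1
(BeurlingCounterexamples): the door is a theorem about ζ's own Laplace transform (poles = zeros);
the barrier bites only a PROOF of the residual from prime-counting axioms, and the residual is
declared RH-equivalent·derived, never staffed.
- Literature.Barriers.RiemannHypothesis.LiouvilleSignConjectures: no one-signedness independent of
RH is asserted — the residual is implied by RH and implies it.
- Negatives index: 4 refuted statements (ShiftedResolvent ×2, CharacterSums, UniversalFactor) — none
concerns Ψ or Landau doors; empty intersection at filing.

sub-problem: RiemannHypothesis · status: draft · opened planner-rh-idea-9-g0-0 2026-08-27T20:35:48Z · rev 0 · ledger route-RiemannHypothesis-ScrewExcursionDoor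
GENERATED by the gate from the ledger (D-0016/17). Provers cite these decls: `theorem foo : Summit.RiemannHypothesis.RiemannHypothesis.Theses.ScrewExcursionDoor.<Decl> := …` in Summits/RiemannHypothesis/RiemannHypothesis/Theorems/<Name>.lean.
-/

namespace Summit.RiemannHypothesis.RiemannHypothesis.Theses.ScrewExcursionDoor

open scoped BigOperators Topology Manifold Classical MeasureTheory ProbabilityTheory Matrix InnerProductSpace ComplexConjugate ContinuousMap
open Filter Set Function TopologicalSpace MeasureTheory

attribute [summit_statement] _root_.Summit.RiemannHypothesis

open Summit

/-- item stmt-RiemannHypothesis-22184 · crux · rank 2 · closed · proved by Summit.RiemannHypothesis.RiemannHypothesis.Theorems.ScrewExcursionDoorExcursionDoor.excursionDoor_proof (prover) · by planner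
why it might fail: Landau's lemma needs the continued transform −Σ m_ρ/(s(s²−κ_ρ²)) + 1/(s−θ) + L_D pole-free on the real ray (max(θ,σ₀,0),∞): a real zero of ζ in (1/2,1) would break it (none: (1−2^{1−σ})ζ(σ) > 0); remaining risk is size (L: Laplace bookkeeping).
sources: Suzuki2023, MontgomeryVaughan2007, doi:10.1007/bf01949062, doi:10.1007/bf01951008
[crux] RH-FREE MEASURE-GRADED LANDAU DOOR: for every η > 0 and θ, σ₀ < η, integrability on [0,∞) of
t ↦ (−Ψ(t) − e^{θt})⁺·e^{−σ₀t} implies QuasiRiemannHypothesis(1/2+η) (no zero of ζ with 1/2+η < Re s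
< 1). [difficulty: L] -/
@[route_item "route-RiemannHypothesis-ScrewExcursionDoor", crux]
def ExcursionDoor : Prop :=
  ∀ η : ℝ, 0 < η → ∀ θ σ₀ : ℝ, θ < η → σ₀ < η → MeasureTheory.IntegrableOn (fun t : ℝ => max (-Literature.NumberTheory.LFunctions.zetaScrew t - Real.exp (θ * t)) 0 * Real.exp (-(σ₀ * t))) (Set.Ici 0) → Literature.NumberTheory.LFunctions.QuasiRiemannHypothesis (1 / 2 + η)

-- `ExcursionDoor` holds: proved by `Summit.RiemannHypothesis.RiemannHypothesis.Theorems.ScrewExcursionDoorExcursionDoor.excursionDoor_proof` (its module imports this route file, so no `_holds` link can be stated here).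

/-- item stmt-RiemannHypothesis-22185 · crux · rank 7 · open · by planner
why it might fail: Equivalent to RH given the door: fails iff ζ has an off-line zero at 1/2+η₁, which forces infinite e^{−σ₀t}-deficit mass on E⁻_θ for all θ, σ₀ < η₁; nobody is asked to prove it.
sources: Suzuki2023, arXiv:2209.12349
[crux] DECLARED RESIDUAL (RH-EQUIVALENT·DERIVED; refutation budget only): for every η > 0 there are
θ, σ₀ < η with the θ-deficit of Ψ of finite e^{−σ₀t}-Laplace mass on [0,∞). ⟸ RH (deficit ≡ 0 with θ
= σ₀ = −1, tree zetaScrew_nonneg_of_RH); ⟹ RH by ExcursionDoor. Instrument: any certified Ψ(t) < 0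
(IntegerScrew node certificates Ψ(log M), screwPivot ladder) refutes RH outright; the excursion
budget ∫_{E⁻_θ} is the object handed to the search. [deps: ExcursionDoor] [difficulty: open-problem] -/
@[route_item "route-RiemannHypothesis-ScrewExcursionDoor", crux]
def ExcursionResidual : Prop :=
  ∀ η : ℝ, 0 < η → ∃ θ σ₀ : ℝ, θ < η ∧ σ₀ < η ∧ MeasureTheory.IntegrableOn (fun t : ℝ => max (-Literature.NumberTheory.LFunctions.zetaScrew t - Real.exp (θ * t)) 0 * Real.exp (-(σ₀ * t))) (Set.Ici 0)

/-- item stmt-RiemannHypothesis-22186 · assembly · rank 1 · closed · proved by Summit.RiemannHypothesis.RiemannHypothesis.Theorems.ScrewExcursionDoor.assembly_proof (prover) · by planner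
sources: Suzuki2023
[assembly] ExcursionDoor → ExcursionResidual → RH (pure logic +
quasiRiemannHypothesis_one_half_iff_holds; `closes` in glue.lean). -/
@[route_item "route-RiemannHypothesis-ScrewExcursionDoor"]
def Assembly : Prop :=
  ExcursionDoor → ExcursionResidual → Summit.RiemannHypothesis

-- `Assembly` holds: proved by `Summit.RiemannHypothesis.RiemannHypothesis.Theorems.ScrewExcursionDoor.assembly_proof` (its module imports this route file, so no `_holds` link can be stated here).

/-! D-0027 §2.1 — DECIDING THEOREM (planner-authored via `route open/edit --closes-file`; by planner-rh-idea-9-g0-0 2026-08-27T20:35:48Z):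
its hypotheses are this route's items and its conclusion the sub-problem Statement (glue_lint), and it elaborates with this file. -/

@[closes "route-RiemannHypothesis-ScrewExcursionDoor"] theorem closes (hD : ExcursionDoor) (hR : ExcursionResidual) : Summit.RiemannHypothesis := by
  show _root_.RiemannHypothesis
  refine Literature.NumberTheory.LFunctions.quasiRiemannHypothesis_one_half_iff_holds.mp fun s hs h0 h1 => ?_
  obtain ⟨θ, σ₀, hθ, hσ, hI⟩ := hR ((s.re - 1 / 2) / 2) (by linarith)
  exact hD ((s.re - 1 / 2) / 2) (by linarith) θ σ₀ hθ hσ hI s hs (by linarith) h1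

end Summit.RiemannHypothesis.RiemannHypothesis.Theses.ScrewExcursionDoor
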